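/-
COR-CM (cell pub-hodgecm2, stage 2 of the Hodge ladder) — count-neutral kernel combinatorics (seat prover-pub-hodgecm2-b23-g40-0, binder
prover b23, gen 40; claim COMPLEMENT-FACES F1, HOME/INBOX.md l.9766).  Bookkeeping definitions with bodies (`wt`, `cls`, `bcls`, `nrep`) +
theorems, in seat b09's intrinsic model (`CMF G c`, `rt`, `oflipCM`, `Block`/`blk`, `cplT`: `CorCM/Prior/AllgGroup1.lean`,
`Census/BlockParityLaw.lean`, `Census/CoinvariantComplement.lean` — consumed BY NAME, nothing restated); no certificate, no `decide`, no
named fact, no geometry, no `sorry`.  `Interfaces.lean` (C1), every E term, B01 and `Transposition/*` are untouched.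
HONEST FRAMING: `HC_CM` is NOT proved, here or anywhere in the tree; nothing here is a period or a headline.
-/
import Summits.HodgeConjecture.CorCM.Census.CoinvariantComplementLaw

/-!
# Faces of a complemented Galois CM type, I: deviation weights, defect classes, blocks, normalised representatives

THE SETTING (seat b09's `Census/CoinvariantComplement.lean`).  `G` a finite group, `c` a CENTRAL involution, and a COMPLEMENT `A ≤ G` of
`c`: `x ∈ A ↔ c·x ∉ A` (`G = A ⊔ cA = A × ⟨c⟩`; for a Galois CM field `F` this says `F ⊇ K` imaginary quadratic, `A = Gal(F/K) ≅ Gal(F⁺/ℚ)`,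
ANY finite group — `S₃`, `D₄`, `Q₈`, `A₄`, `ℤ/7 ⋊ ℤ/3`, …).  The complement is itself a CM type `T = cplT` and every CM type `Ψ` is
determined by its DEVIATION SET `T ∖ Ψ ⊆ A` (the places of `A` at which `Ψ` takes `c·a` instead of `a`).

CONTENT (the dictionary of the lane COMPLEMENT-FACES; parts II–IV: canonical squares and the class descent, the two closing arguments,
the main theorem `μ(G, c) = β(G, c) − 1 − δ(G, c)` attained by rank-four faces for EVERY complemented central involution; part V the field
form).
* §1 For ANY base type `T`: the **weight** `wt T Ψ = |T ∖ Ψ|` and the **defect class** `cls T Ψ = min (wt, |T| − wt)`; conjugation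
  reverses the weight (`wt_rt_self`: `wt (Ψ·c) = |T| − wt Ψ`, central `c`) and keeps the class; a flip moves the weight by one
  (`wt_oflipCM_of_notMem` / `wt_oflipCM_of_mem`); weight `0` is `T`, weight `1` is a single flip `T^{(d)}`; every weight `≤ |T|` occurs.
* §2 For `T = cplT` the complement: base change along `a ∈ A` keeps the weight (`wt_rt_of_mem`: `T ∖ Ψ·a⁻¹ = (T ∖ Ψ)·a⁻¹`), so the
  class is constant on BLOCKS (`cls_rt`, `cls_eq_of_blk_eq`; `bcls B`); every block has a NORMALISED representative `nrep B`
  (`wt (nrep B) = bcls B ≤ |A|/2`); the types of class `0` form the block of `T`, those of class `1` the block of `T^{(1)}`, and these two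
  blocks are distinct once `|A| ≥ 2` — so at most `β − 2` blocks have class `≥ 2` (`card_filter_two_le_bcls_add_two_le`).
No commutativity of `A` is used anywhere in the lane (only `rt_mul`, the centrality of `c`, and — in part IV — the normality of the
index-two subgroup `A`).  All [folklore] bookkeeping over [Pohlmann1968, Thm 1] in the reading of [Milne1999, Prop. 2.1].

## References
* [Pohlmann1968] H. Pohlmann, Algebraic cycles on abelian varieties of complex multiplication type, Ann. of Math. 88 (1968), Thm 1.
* [Milne1999] J. S. Milne, Lefschetz motives and the Tate conjecture, Compositio Math. 117 (1999), Prop. 2.1, p. 54.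
-/

namespace Summit.HodgeConjecture.CorCM.Census.ComplementFaces

open Finset
open scoped symmDiff
open Summit.HodgeConjecture.CorCM.Prior.AllgGroup.RfwfAllgGroup
open Summit.HodgeConjecture.CorCM.Census.BlockParity
open Summit.HodgeConjecture.CorCM.Census.Coinvariant

noncomputable section

variable {G : Type*} [Group G] [Fintype G] [DecidableEq G] (c : G)

/-! ## §1 Weight and defect class relative to a base type -/

/-- **The deviation weight** of `Ψ` relative to the base type `T`: the number of places at which `Ψ` deviates from `T` (`|T ∖ Ψ|`).
[folklore] -/
def wt (T Ψ : CMF G c) : ℕ := (T.1 \ Ψ.1).card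

/-- **The defect class** `min (wt, |T| − wt)` of `Ψ` relative to `T` (the weight of `Ψ` or of its conjugate, whichever is smaller).
[folklore] -/
def cls (T Ψ : CMF G c) : ℕ := min (wt c T Ψ) (T.1.card - wt c T Ψ)

/-- The weight is at most `|T|`. [folklore] -/
theorem wt_le (T Ψ : CMF G c) : wt c T Ψ ≤ T.1.card := card_le_card sdiff_subset

/-- The base type has weight `0`. [folklore] -/
@[simp] theorem wt_self (T : CMF G c) : wt c T T = 0 := by simp [wt]

/-- The class is at most the weight. [folklore] -/
theorem cls_le_wt (T Ψ : CMF G c) : cls c T Ψ ≤ wt c T Ψ := min_le_left _ _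

/-- The class is at most the co-weight. [folklore] -/
theorem cls_le_sub (T Ψ : CMF G c) : cls c T Ψ ≤ T.1.card - wt c T Ψ := min_le_right _ _

/-- Twice the class is at most `|T|`. [folklore] -/
theorem two_mul_cls_le (T Ψ : CMF G c) : 2 * cls c T Ψ ≤ T.1.card := by
  have h1 := cls_le_wt c T Ψ
  have h2 := cls_le_sub c T Ψ
  have h3 := wt_le c T Ψ
  omega

/-- The class is the weight or the co-weight. [folklore] -/
theorem cls_eq_or (T Ψ : CMF G c) : cls c T Ψ = wt c T Ψ ∨ cls c T Ψ = T.1.card - wt c T Ψ := by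
  unfold cls
  rcases le_total (wt c T Ψ) (T.1.card - wt c T Ψ) with h | h
  · exact Or.inl (min_eq_left h)
  · exact Or.inr (min_eq_right h)

/-- A light type (`wt ≤ |T| − wt`) has class `= wt`. [folklore] -/
theorem cls_eq_wt_of_le {T Ψ : CMF G c} (h : wt c T Ψ ≤ T.1.card - wt c T Ψ) : cls c T Ψ = wt c T Ψ := min_eq_left h

/-- A heavy type (`|T| − wt ≤ wt`) has class `= |T| − wt`. [folklore] -/
theorem cls_eq_sub_of_le {T Ψ : CMF G c} (h : T.1.card - wt c T Ψ ≤ wt c T Ψ) : cls c T Ψ = T.1.card - wt c T Ψ :=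
  min_eq_right h

/-- The base type has class `0`. [folklore] -/
@[simp] theorem cls_self (T : CMF G c) : cls c T T = 0 := by simp [cls]

/-- **The deviation set of the conjugate** (central `c`): `T ∖ Ψ·c = T ∖ (T ∖ Ψ) = T ∩ Ψ`. [folklore] -/
theorem sdiff_rt_self (hcen : ∀ x : G, x * c = c * x) (T Ψ : CMF G c) : T.1 \ (rt c c Ψ).1 = T.1 \ (T.1 \ Ψ.1) := by
  ext x
  simp only [mem_sdiff, mem_rt, hcen x]
  have h := Ψ.2 x
  tauto

/-- **Conjugation reverses the weight**: `wt (Ψ·c) = |T| − wt Ψ` (central `c`). [folklore] -/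
theorem wt_rt_self (hcen : ∀ x : G, x * c = c * x) (T Ψ : CMF G c) : wt c T (rt c c Ψ) = T.1.card - wt c T Ψ := by
  unfold wt
  rw [sdiff_rt_self c hcen, card_sdiff_of_subset sdiff_subset]

/-- **Conjugation keeps the class.** [folklore] -/
theorem cls_rt_self (hcen : ∀ x : G, x * c = c * x) (T Ψ : CMF G c) : cls c T (rt c c Ψ) = cls c T Ψ := by
  unfold cls
  rw [wt_rt_self c hcen, Nat.sub_sub_self (wt_le c T Ψ), min_comm]

/-- **A flip at a deviation place lowers the weight by one.** [folklore] -/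
theorem wt_oflipCM_of_notMem (hc2 : c * c = 1) {T Ψ : CMF G c} {d : G} (hd : d ∈ T.1) (hdΨ : d ∉ Ψ.1) :
    wt c T (oflipCM c hc2 d Ψ) + 1 = wt c T Ψ := by
  unfold wt
  rw [dev_oflip c hc2 hd hdΨ, card_erase_add_one (mem_sdiff.mpr ⟨hd, hdΨ⟩)]

/-- **A flip at an agreement place raises the weight by one.** [folklore] -/
theorem wt_oflipCM_of_mem (hc2 : c * c = 1) {T Ψ : CMF G c} {d : G} (hd : d ∈ T.1) (hdΨ : d ∈ Ψ.1) :
    wt c T (oflipCM c hc2 d Ψ) = wt c T Ψ + 1 := by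
  unfold wt
  rw [dev_oflip_of_mem c hc2 hd hdΨ, card_insert_of_notMem (fun h => (mem_sdiff.mp h).2 hdΨ)]

/-- A single flip of the base type has weight `1`. [folklore] -/
theorem wt_oflipCM_self (hc2 : c * c = 1) {T : CMF G c} {d : G} (hd : d ∈ T.1) : wt c T (oflipCM c hc2 d T) = 1 := by
  rw [wt_oflipCM_of_mem c hc2 hd hd, wt_self]

/-- **Weight `0` is the base type.** [folklore] -/
theorem eq_of_wt_eq_zero {T Ψ : CMF G c} (h : wt c T Ψ = 0) : Ψ = T := eq_of_dev_empty c (card_eq_zero.mp h)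

/-- **Weight `1` is a single flip of the base type.** [folklore] -/
theorem exists_eq_oflipCM_of_wt_eq_one (hc2 : c * c = 1) {T Ψ : CMF G c} (h : wt c T Ψ = 1) :
    ∃ d ∈ T.1, Ψ = oflipCM c hc2 d T := by
  obtain ⟨d, hd⟩ := card_eq_one.mp h
  have hmem : d ∈ T.1 \ Ψ.1 := by rw [hd]; exact mem_singleton_self d
  exact ⟨d, (mem_sdiff.mp hmem).1, eq_oflip_of_dev_singleton c hc2 hd⟩

/-- A type of weight `≥ 2` deviates at two distinct places of `T`. [folklore] -/
theorem exists_two_devs {T Ψ : CMF G c} (h : 2 ≤ wt c T Ψ) :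
    ∃ d d' : G, d ∈ T.1 ∧ d ∉ Ψ.1 ∧ d' ∈ T.1 ∧ d' ∉ Ψ.1 ∧ d ≠ d' := by
  obtain ⟨d, hd, d', hd', hne⟩ := one_lt_card.mp (show 1 < (T.1 \ Ψ.1).card from h)
  exact ⟨d, d', (mem_sdiff.mp hd).1, (mem_sdiff.mp hd).2, (mem_sdiff.mp hd').1, (mem_sdiff.mp hd').2, hne⟩

/-- A type of weight `< |T|` agrees with `T` at some place. [folklore] -/
theorem exists_mem_of_wt_lt {T Ψ : CMF G c} (h : wt c T Ψ < T.1.card) : ∃ d ∈ T.1, d ∈ Ψ.1 := by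
  have hne : (T.1 \ (T.1 \ Ψ.1)).Nonempty := by
    rw [← card_pos, card_sdiff_of_subset sdiff_subset]
    unfold wt at h
    omega
  obtain ⟨d, hd⟩ := hne
  rw [mem_sdiff] at hd
  refine ⟨d, hd.1, ?_⟩
  by_contra hdΨ
  exact hd.2 (mem_sdiff.mpr ⟨hd.1, hdΨ⟩)

/-- **Every weight `≤ |T|` occurs.** [folklore] -/
theorem exists_wt_eq (hc2 : c * c = 1) (T : CMF G c) : ∀ k ≤ T.1.card, ∃ Ψ : CMF G c, wt c T Ψ = k := by
  intro k
  induction k with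
  | zero => exact fun _ => ⟨T, wt_self c T⟩
  | succ k ih =>
    intro hk
    obtain ⟨Ψ, hΨ⟩ := ih (by omega)
    obtain ⟨d, hd, hdΨ⟩ := exists_mem_of_wt_lt c (T := T) (Ψ := Ψ) (by omega)
    exact ⟨oflipCM c hc2 d Ψ, by rw [wt_oflipCM_of_mem c hc2 hd hdΨ, hΨ]⟩

/-- Distinct single flips of the base type are distinct types (their deviation sets are `{d} ≠ {d'}`). [folklore] -/
theorem oflipCM_self_injOn (hc2 : c * c = 1) {T : CMF G c} {d d' : G} (hd : d ∈ T.1) (hd' : d' ∈ T.1)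
    (h : oflipCM c hc2 d T = oflipCM c hc2 d' T) : d = d' := by
  have h1 : T.1 \ (oflipCM c hc2 d T).1 = {d} := by
    rw [dev_oflip_of_mem c hc2 hd hd, sdiff_self]; rfl
  have h2 : T.1 \ (oflipCM c hc2 d' T).1 = {d'} := by
    rw [dev_oflip_of_mem c hc2 hd' hd', sdiff_self]; rfl
  rw [h, h2] at h1
  exact (singleton_injective h1).symm

/-- A single flip of the base type is not the base type. [folklore] -/
theorem oflipCM_self_ne (hc2 : c * c = 1) {T : CMF G c} {d : G} (hd : d ∈ T.1) : oflipCM c hc2 d T ≠ T := by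
  intro h
  have h1 := wt_oflipCM_self c hc2 hd
  rw [h, wt_self] at h1
  exact zero_ne_one h1

/-! ## §2 The complement as base type: base change along `A`, blocks, normalised representatives -/

section Complement

variable {A : Subgroup G} (hA : ∀ x : G, x ∈ A ↔ c * x ∉ A)

/-- **The deviation set of a base change along the complement is the translated deviation set**: `T ∖ Ψ·a⁻¹ = (T ∖ Ψ)·a⁻¹`.
[folklore] -/
theorem sdiff_rt_of_mem {a : G} (ha : a ∈ A) (Ψ : CMF G c) :
    (cplT c A hA).1 \ (rt c a Ψ).1 = ((cplT c A hA).1 \ Ψ.1).image (· * a⁻¹) := by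
  ext x
  simp only [mem_sdiff, mem_cplT, mem_rt, mem_image]
  constructor
  · rintro ⟨hx, hxΨ⟩
    exact ⟨x * a, ⟨A.mul_mem hx ha, hxΨ⟩, by rw [mul_inv_cancel_right]⟩
  · rintro ⟨y, ⟨hy, hyΨ⟩, rfl⟩
    exact ⟨A.mul_mem hy (A.inv_mem ha), by rwa [inv_mul_cancel_right]⟩

/-- **Base change along the complement keeps the weight.** [folklore] -/
theorem wt_rt_of_mem {a : G} (ha : a ∈ A) (Ψ : CMF G c) : wt c (cplT c A hA) (rt c a Ψ) = wt c (cplT c A hA) Ψ := by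
  unfold wt
  rw [sdiff_rt_of_mem c hA ha, card_image_of_injective _ (mul_left_injective a⁻¹)]

/-- **Every base change keeps the class** (along `a ∈ A` the weight is kept, along `c·a` it is reversed). [folklore] -/
theorem cls_rt (hc2 : c * c = 1) (hcen : ∀ x : G, x * c = c * x) (Q : G) (Ψ : CMF G c) :
    cls c (cplT c A hA) (rt c Q Ψ) = cls c (cplT c A hA) Ψ := by
  by_cases hQ : Q ∈ A
  · unfold cls; rw [wt_rt_of_mem c hA hQ]
  · have hcQ : c * Q ∈ A := cmul_mem_cpl c hA hQ
    conv_lhs => rw [← cmul_cmul c hc2 Q, rt_mul, cls_rt_self c hcen]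
    unfold cls; rw [wt_rt_of_mem c hA hcQ]

/-- **The class is constant on blocks.** [folklore] -/
theorem cls_eq_of_blk_eq (hc2 : c * c = 1) (hcen : ∀ x : G, x * c = c * x) {Ψ Ψ' : CMF G c} (h : blk c Ψ = blk c Ψ') :
    cls c (cplT c A hA) Ψ = cls c (cplT c A hA) Ψ' := by
  obtain ⟨Q, rfl⟩ := exists_rt_eq_of_blk_eq c h
  exact (cls_rt c hA hc2 hcen Q Ψ).symm

/-- **The class of a block** (read at its canonical representative). [folklore] -/
def bcls (B : Block c) : ℕ := cls c (cplT c A hA) B.out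

/-- The class of a type is the class of its block. [folklore] -/
theorem cls_eq_bcls (hc2 : c * c = 1) (hcen : ∀ x : G, x * c = c * x) (Ψ : CMF G c) :
    cls c (cplT c A hA) Ψ = bcls c hA (blk c Ψ) := by
  have h : blk c (blk c Ψ).out = blk c Ψ := Quotient.out_eq _
  exact cls_eq_of_blk_eq c hA hc2 hcen h.symm

/-- Twice the class of a block is at most `|A|`. [folklore] -/
theorem two_mul_bcls_le (B : Block c) : 2 * bcls c hA B ≤ (cplT c A hA).1.card := two_mul_cls_le c _ _

/-- **Every block has a normalised representative** (of weight `= class ≤ |A|/2`: a type or its conjugate). [folklore] -/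
theorem exists_nrep (hcen : ∀ x : G, x * c = c * x) (B : Block c) :
    ∃ ρ : CMF G c, blk c ρ = B ∧ wt c (cplT c A hA) ρ = bcls c hA B := by
  by_cases h : wt c (cplT c A hA) B.out ≤ (cplT c A hA).1.card - wt c (cplT c A hA) B.out
  · exact ⟨B.out, Quotient.out_eq _, (cls_eq_wt_of_le c h).symm⟩
  · refine ⟨rt c c B.out, by rw [blk_rt]; exact Quotient.out_eq _, ?_⟩
    rw [wt_rt_self c hcen, bcls, cls_eq_sub_of_le c (by omega)]

/-- **The normalised representative** of a block. [folklore] -/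
def nrep (hcen : ∀ x : G, x * c = c * x) (B : Block c) : CMF G c := (exists_nrep c hA hcen B).choose

/-- The normalised representative lies in its block. [folklore] -/
@[simp] theorem blk_nrep (hcen : ∀ x : G, x * c = c * x) (B : Block c) : blk c (nrep c hA hcen B) = B :=
  (exists_nrep c hA hcen B).choose_spec.1

/-- The normalised representative has weight `=` the class of the block. [folklore] -/
theorem wt_nrep (hcen : ∀ x : G, x * c = c * x) (B : Block c) : wt c (cplT c A hA) (nrep c hA hcen B) = bcls c hA B :=
  (exists_nrep c hA hcen B).choose_spec.2

/-- The normalised representative has class `=` the class of the block. [folklore] -/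
theorem cls_nrep (hc2 : c * c = 1) (hcen : ∀ x : G, x * c = c * x) (B : Block c) :
    cls c (cplT c A hA) (nrep c hA hcen B) = bcls c hA B := by
  rw [cls_eq_bcls c hA hc2 hcen, blk_nrep]

/-- Every type of a block is a base change of the normalised representative. [folklore] -/
theorem exists_rt_nrep_eq (hcen : ∀ x : G, x * c = c * x) (Ψ : CMF G c) : ∃ Q : G, rt c Q (nrep c hA hcen (blk c Ψ)) = Ψ :=
  exists_rt_eq_of_blk_eq c (blk_nrep c hA hcen (blk c Ψ))

/-- The complement type has class `0` in its own block. [folklore] -/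
theorem bcls_blk_cplT (hc2 : c * c = 1) (hcen : ∀ x : G, x * c = c * x) : bcls c hA (blk c (cplT c A hA)) = 0 := by
  rw [← cls_eq_bcls c hA hc2 hcen, cls_self]

/-- A single flip of the complement type has class `1` once `|A| ≥ 2`. [folklore] -/
theorem cls_oflipCM_cplT (hc2 : c * c = 1) (h2 : 2 ≤ (cplT c A hA).1.card) {d : G} (hd : d ∈ A) :
    cls c (cplT c A hA) (oflipCM c hc2 d (cplT c A hA)) = 1 := by
  have hd' : d ∈ (cplT c A hA).1 := (mem_cplT c hA d).mpr hd
  rw [cls_eq_wt_of_le c (by rw [wt_oflipCM_self c hc2 hd']; omega), wt_oflipCM_self c hc2 hd']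

/-- **A type of class `0` lies in the block of the complement type** (it is `T` or `T̄ = T·c`). [folklore] -/
theorem blk_eq_blk_cplT_of_cls_eq_zero (hcen : ∀ x : G, x * c = c * x) {Ψ : CMF G c} (h : cls c (cplT c A hA) Ψ = 0) :
    blk c Ψ = blk c (cplT c A hA) := by
  rcases cls_eq_or c (cplT c A hA) Ψ with h0 | hn
  · rw [eq_of_wt_eq_zero c (show wt c (cplT c A hA) Ψ = 0 by omega)]
  · have hw : wt c (cplT c A hA) (rt c c Ψ) = 0 := by
      rw [wt_rt_self c hcen]; have := wt_le c (cplT c A hA) Ψ; omega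
    rw [← blk_rt c c Ψ, eq_of_wt_eq_zero c hw]

/-- **A type of class `1` lies in the block of `T^{(1)}`** (it is a single flip `T^{(d)} = T^{(1)}·d⁻¹` or the conjugate of one).
[folklore] -/
theorem blk_eq_blk_oflipCM_of_cls_eq_one (hc2 : c * c = 1) (hcen : ∀ x : G, x * c = c * x) {Ψ : CMF G c}
    (h : cls c (cplT c A hA) Ψ = 1) : blk c Ψ = blk c (oflipCM c hc2 1 (cplT c A hA)) := by
  -- a single flip `T^{(d)}`, `d ∈ A`, is the base change of `T^{(1)}` along `d⁻¹`
  have key : ∀ {Φ : CMF G c}, wt c (cplT c A hA) Φ = 1 → blk c Φ = blk c (oflipCM c hc2 1 (cplT c A hA)) := by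
    intro Φ hΦ
    obtain ⟨d, hd, rfl⟩ := exists_eq_oflipCM_of_wt_eq_one c hc2 hΦ
    have hdA : d ∈ A := (mem_cplT c hA d).mp hd
    rw [← blk_rt c d⁻¹ (oflipCM c hc2 1 (cplT c A hA)), rt_oflipCM_cplT c hc2 hA (A.inv_mem hdA), inv_inv, one_mul]
  rcases cls_eq_or c (cplT c A hA) Ψ with h1 | hn
  · exact key (by omega)
  · have hw : wt c (cplT c A hA) (rt c c Ψ) = 1 := by
      rw [wt_rt_self c hcen]; have := wt_le c (cplT c A hA) Ψ; omega
    rw [← blk_rt c c Ψ]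
    exact key hw

/-- The blocks of `T` and of `T^{(1)}` are distinct once `|A| ≥ 2` (classes `0 ≠ 1`). [folklore] -/
theorem blk_cplT_ne_blk_oflipCM (hc2 : c * c = 1) (hcen : ∀ x : G, x * c = c * x) (h2 : 2 ≤ (cplT c A hA).1.card) :
    blk c (cplT c A hA) ≠ blk c (oflipCM c hc2 1 (cplT c A hA)) := by
  intro h
  have h' := cls_eq_of_blk_eq c hA hc2 hcen h
  rw [cls_self, cls_oflipCM_cplT c hA hc2 h2 A.one_mem] at h'
  exact zero_ne_one h'

/-- **At most `β − 2` blocks have class `≥ 2`** (`|A| ≥ 2`): the blocks of `T` (class `0`) and of `T^{(1)}` (class `1`) do not.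
[folklore] -/
theorem card_filter_two_le_bcls_add_two_le (hc2 : c * c = 1) (hcen : ∀ x : G, x * c = c * x) (h2 : 2 ≤ (cplT c A hA).1.card) :
    (univ.filter fun B : Block c => 2 ≤ bcls c hA B).card + 2 ≤ Fintype.card (Block c) := by
  classical
  set B₀ : Block c := blk c (cplT c A hA) with hB₀
  set B₁ : Block c := blk c (oflipCM c hc2 1 (cplT c A hA)) with hB₁
  have hne : B₀ ≠ B₁ := blk_cplT_ne_blk_oflipCM c hA hc2 hcen h2
  have h0 : bcls c hA B₀ = 0 := bcls_blk_cplT c hA hc2 hcen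
  have h1 : bcls c hA B₁ = 1 := by rw [hB₁, ← cls_eq_bcls c hA hc2 hcen, cls_oflipCM_cplT c hA hc2 h2 A.one_mem]
  have hsub : (univ.filter fun B : Block c => 2 ≤ bcls c hA B) ⊆ univ \ {B₀, B₁} := by
    intro B hB
    rw [mem_filter] at hB
    rw [mem_sdiff, mem_insert, mem_singleton]
    refine ⟨mem_univ _, ?_⟩
    rintro (rfl | rfl) <;> omega
  have hcard := card_le_card hsub
  rw [card_sdiff_of_subset (subset_univ _), card_univ, card_pair hne] at hcard
  have hβ : 2 ≤ Fintype.card (Block c) := by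
    have : ({B₀, B₁} : Finset (Block c)).card ≤ Fintype.card (Block c) := by
      rw [← card_univ]; exact card_le_card (subset_univ _)
    rwa [card_pair hne] at this
  omega

/-- `|A| = |T| ≥ 1`. [folklore] -/
theorem one_le_card_cplT : 1 ≤ (cplT c A hA).1.card :=
  card_pos.mpr ⟨1, (mem_cplT c hA 1).mpr A.one_mem⟩

end Complement

end

end Summit.HodgeConjecture.CorCM.Census.ComplementFaces
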